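import Mathlib
import HarnessLib
import Summits.ValiantsHypothesis.ValiantsHypothesis.Theorems.SymmetryDialBentCThree

/-!
# SymmetryDial — the `C³`-type of a bent Cayley structure is exactly `(wt f, f 0)`

Route `SymmetryDial` (workshop `decomp-valiant`, lens 1, gen 8), item 23711 (P′ = `AffinePebblePairs`).
Capstone of (B): combining `SymmetryDialBentCThree.bentCThreeBlind` (sufficiency) with
`SymmetryDialWalsh.wt_eq_of_pebbleEquiv_three` (three pebble pairs see the weight) and the one-pebble
observation `apply_zero_eq_of_pebbleEquiv` (the diagonal colour `M_f(a,a) = f 0` is seen by a single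
pebble pair), for bent `f, g : 𝔽₂^d → 𝔽₂`:
`𝔄(M_f) ≡_{C³} 𝔄(M_g) ↔ (wt f = wt g ∧ f 0 = g 0)` (`pebbleEquiv_three_iff_of_bent`), and the same for
every `1 ≤ k′ ≤ 3` (`pebbleEquiv_iff_of_bent_of_le_three`).  So on the bent habitat the census
instrument at `k′ ≤ 3` has exactly the four classes `(2^{d-1} ± 2^{d/2-1}, f 0 ∈ {0,1})` and pebble
number `≥ 4` is necessary to separate any two GL-inequivalent bent functions of the same class
(LADDER-Valiant rung 0: instrument calibration; nothing here bears on VP ≠ VNP).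
-/

namespace Summit.ValiantsHypothesis.ValiantsHypothesis.Theorems.SymmetryDialBentCThreeType

open Finset
open Literature.ModelTheory.FiniteModelTheory
open SymmetryDialAffinePebble (V AffRel Laff pair RelHolds affStr AffinePebbleEquiv)
open SymmetryDialAffinePebbleThree (grpMat exists_inl_of_partialIso mat_iff_of_partialIso)
open SymmetryDialWalsh (wt wt_eq_of_pebbleEquiv_three)
open SymmetryDialBent (IsBent)

variable {d : ℕ}

/-- **One pebble pair sees the diagonal colour**: `𝔄(M_f) ≡_{C^{k′}} 𝔄(M_g)` with `k′ ≥ 1` forces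
`f 0 = g 0` (Spoiler pebbles a point `a ↦ a'`; the partial isomorphism gives
`M_f(a,a) = f 0 ↔ M_g(a',a') = g 0`). -/
theorem apply_zero_eq_of_pebbleEquiv {k : ℕ} (hk : 0 < k) (f g : V d → Bool)
    (h : AffinePebbleEquiv k d (grpMat f) (grpMat g)) : f 0 = g 0 := by
  classical
  obtain ⟨S, hS⟩ := h
  obtain ⟨e, he⟩ := S.move S.empty_mem ⟨0, hk⟩
  have hmem := he (Sum.inl 0)
  set p : PebblePosition k (V d ⊕ V d) (V d ⊕ V d) :=
    Function.update PebblePosition.empty ⟨0, hk⟩ (some (Sum.inl (0 : V d), e (Sum.inl 0))) with hp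
  have hpeb : p.Pebbled (Sum.inl 0) (e (Sum.inl 0)) := ⟨⟨0, hk⟩, by simp [hp]⟩
  obtain ⟨b, hb⟩ := exists_inl_of_partialIso (hS hmem) hpeb
  rw [hb] at hpeb
  have hmat := mat_iff_of_partialIso (hS hmem) hpeb hpeb
  simp only [grpMat, add_zero, SymmetryDialPerCongruence.two_nsmul_eq_zero] at hmat
  rw [Bool.eq_iff_iff, hmat]

/-- **The `C³`-type of a bent Cayley structure is exactly `(wt, f 0)`.** -/
theorem pebbleEquiv_three_iff_of_bent {f g : V d → Bool} (hf : IsBent f) (hg : IsBent g) :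
    AffinePebbleEquiv 3 d (grpMat f) (grpMat g) ↔ (wt f = wt g ∧ f 0 = g 0) :=
  ⟨fun h => ⟨wt_eq_of_pebbleEquiv_three f g h, apply_zero_eq_of_pebbleEquiv (by norm_num) f g h⟩,
    fun h => SymmetryDialBentCThree.bentCThreeBlind d f g hf hg h.1 h.2⟩

/-- Downward monotonicity makes the sufficiency hold for every `k′ ≤ 3`. -/
theorem pebbleEquiv_of_bent_of_le_three {k : ℕ} (hk : k ≤ 3) {f g : V d → Bool} (hf : IsBent f)
    (hg : IsBent g) (hwt : wt f = wt g) (h0 : f 0 = g 0) : AffinePebbleEquiv k d (grpMat f) (grpMat g) :=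
  SymmetryDialAffinePebble.affinePebbleEquiv_mono hk
    (SymmetryDialBentCThree.bentCThreeBlind d f g hf hg hwt h0)

/-- The necessity of `f 0 = g 0` holds from one pebble pair on; that of `wt f = wt g` needs three (two
pebble pairs do not see the weight in general — cf. the `k′ = 2` game of `SymmetryDialAffinePebbleTwo`). -/
theorem apply_zero_eq_of_pebbleEquiv_pos {k : ℕ} (hk : 1 ≤ k) {f g : V d → Bool}
    (h : AffinePebbleEquiv k d (grpMat f) (grpMat g)) : f 0 = g 0 :=
  apply_zero_eq_of_pebbleEquiv hk f g h

end Summit.ValiantsHypothesis.ValiantsHypothesis.Theorems.SymmetryDialBentCThreeType
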